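import Mathlib
import Summits.Ventures.PercRepro2.Defs
import Summits.Ventures.PercRepro2.Independence
import Summits.Ventures.PercRepro2.Harris
import Summits.Ventures.PercRepro2.Graph
import Summits.Ventures.PercRepro2.Exploration
import Summits.Ventures.PercRepro2.Events
import Summits.Ventures.PercRepro2.FourFunctions
import Summits.Ventures.PercRepro2.Induced
import Summits.Ventures.PercRepro2.Frontier
import Summits.Ventures.PercRepro2.ObsIndependence
import Summits.Ventures.PercRepro2.BHK
import Summits.Ventures.PercRepro2.BHKEvents
import Summits.Ventures.PercRepro2.VdBKahn
import Summits.Ventures.PercRepro2.BHKAvoid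
import Summits.Ventures.PercRepro2.OrderPreservation
import Summits.Ventures.PercRepro2.OrderPreservationDual
import Summits.Ventures.PercRepro2.OrderPreservationQuant
import Summits.Ventures.PercRepro2.Merge
import Summits.Ventures.PercRepro2.OrderPreservationUnion
import Summits.Ventures.PercRepro2.R2PrimeThreeReduction
import Summits.Ventures.PercRepro2.YBridge
import Summits.Ventures.PercRepro2.EdgeBHK
import Summits.Ventures.PercRepro2.N0
import Summits.Ventures.PercRepro2.Rungs
import Summits.Ventures.PercRepro2.HF2
import Summits.Ventures.PercRepro2.ZIdentities
import Summits.Ventures.PercRepro2.ZReduction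
import Summits.Ventures.PercRepro2.Yu1Functionals
import Summits.Ventures.PercRepro2.Yu1Events
import Summits.Ventures.PercRepro2.Yu1
import Summits.Ventures.PercRepro2.YDelta
import Summits.Ventures.PercRepro2.YDeltaTools
import Summits.Ventures.PercRepro2.YDeltaRegime
import Summits.Ventures.PercRepro2.ZReductionSum

/-!
# Z and R2′(3) in the regime `P(PD) ≤ M₂ + Δ_T` (blind cell PercRepro2, p1)

* `zsum_of_regime`: the crux statement Z (the body of typer-1's `ZDelta`: the SUM of the two
  Δ-corrected pieces) holds whenever `P(PD) ≤ M₂ + Δ_T`, from the two regime theorems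
  `yu1Delta_of_regime`, `yu2Delta_of_regime` (`YDeltaRegime`);
* `scprime_of_regime`: hence SC′ in that regime (`scprime_of_Zsum`);
* `r2prime3_of_regime`: hence **R2′(3)** — Kozma–Nitzan's pre-FKG inequality (3) at `#A = 3` and the
  minimiser `a₃` — is a THEOREM in the regime `P(PD) ≤ M₂ + Δ_T` (plus the orders and the
  distinctness of the roots): `P(o ↔ {a₃, a₁, a₂}, o ↔ b) ≥ P(o ↔ {a₃, a₁, a₂}, a₃ ↔ b)`.
(`proofs/LEAD-PROOFSHAPES.md` §8.9 ADDENDUM 17 (3)(iii), (5)(a).)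
-/

namespace Summit.Ventures.PercRepro2

open UnionCluster

section ZRegime

variable {V : Type*} {E : Type*} [Fintype E] [DecidableEq E] [Fintype V] [DecidableEq V]
  {R : Type*} [Field R] [LinearOrder R] [IsStrictOrderedRing R]

/-- **Z in the regime**: `P(PD) ≤ M₂ + Δ_T` (and the labelling, `b ≠ a₁`, `b ≠ a₂`) give the body of
`ZDelta`. -/
theorem zsum_of_regime (p : E → R) (hp : IsProbVec p) (ends : E → Sym2 V) {o a₁ a₂ a₃ b : V}
    (hb1 : b ≠ a₁) (hb2 : b ≠ a₂)
    (hord : prob p (connEvent ends a₁ b) ≤ prob p (connEvent ends a₂ b))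
    (hreg : prob p (PDEvent ends a₁ a₂ a₃) ≤ massM2 p ends a₁ a₂ a₃ b + deltaT p ends a₁ a₂ a₃ b) :
    ((prob p (PDEvent ends a₁ a₂ a₃ ∩ connEvent ends a₁ o ∩ connEvent ends a₂ b) -
          deltaL p ends o a₁ a₂ a₃ b) +
        (prob p (PDEvent ends a₁ a₂ a₃ ∩ connEvent ends a₂ o ∩ connEvent ends a₁ b) -
          deltaH p ends o a₁ a₂ a₃ b)) * prob p (PDEvent ends a₁ a₂ a₃) ≤
      (prob p (PDEvent ends a₁ a₂ a₃ ∩ connEvent ends a₁ o) +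
          prob p (PDEvent ends a₁ a₂ a₃ ∩ connEvent ends a₂ o)) *
        (massM2 p ends a₁ a₂ a₃ b + deltaT p ends a₁ a₂ a₃ b) := by
  have h1 := yu1Delta_of_regime p hp ends (o := o) hb2 hreg
  have h2 := yu2Delta_of_regime p hp ends (o := o) hb1 hord hreg
  rw [deltaL_eq, deltaH_eq, add_mul, add_mul]
  linarith

/-- **SC′ in the regime `P(PD) ≤ M₂ + Δ_T`.** -/
theorem scprime_of_regime (p : E → R) (hp : IsProbVec p) (ends : E → Sym2 V) {o a₁ a₂ a₃ b : V}
    (h12 : a₁ ≠ a₂) (h31 : a₃ ≠ a₁) (ho : o ≠ a₁) (hb1 : b ≠ a₁) (hb2 : b ≠ a₂)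
    (hPD : 0 < prob p (PDEvent ends a₁ a₂ a₃))
    (hreg : prob p (PDEvent ends a₁ a₂ a₃) ≤ massM2 p ends a₁ a₂ a₃ b + deltaT p ends a₁ a₂ a₃ b)
    (hord : prob p (connEvent ends a₁ b) ≤ prob p (connEvent ends a₂ b))
    (h3 : prob p (connEvent ends a₃ b) ≤ prob p (connEvent ends a₁ b)) :
    SCPrimeIneq p ends o a₃ a₁ a₂ b :=
  scprime_of_Zsum p hp ends h12 h31 ho hPD (zsum_of_regime p hp ends hb1 hb2 hord hreg) hord h3

/-- **R2′(3) in the regime `P(PD) ≤ M₂ + Δ_T`**: for distinct roots with the orders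
`P(a₃ ↔ b) ≤ P(a₁ ↔ b) ≤ P(a₂ ↔ b)`, `P(o ↔ {a₃, a₁, a₂}, o ↔ b) ≥ P(o ↔ {a₃, a₁, a₂}, a₃ ↔ b)`. -/
theorem r2prime3_of_regime (p : E → R) (hp : IsProbVec p) (ends : E → Sym2 V) {o a₁ a₂ a₃ b : V}
    (h12 : a₁ ≠ a₂) (h31 : a₃ ≠ a₁) (h32 : a₃ ≠ a₂) (ho : o ≠ a₁) (ho2 : o ≠ a₂)
    (hb1 : b ≠ a₁) (hb2 : b ≠ a₂) (hPD : 0 < prob p (PDEvent ends a₁ a₂ a₃))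
    (hreg : prob p (PDEvent ends a₁ a₂ a₃) ≤ massM2 p ends a₁ a₂ a₃ b + deltaT p ends a₁ a₂ a₃ b)
    (hord : prob p (connEvent ends a₁ b) ≤ prob p (connEvent ends a₂ b))
    (h3 : prob p (connEvent ends a₃ b) ≤ prob p (connEvent ends a₁ b)) :
    prob p (hitEvent ends o {a₃, a₁, a₂} ∩ connEvent ends o b) ≥
      prob p (hitEvent ends o {a₃, a₁, a₂} ∩ connEvent ends a₃ b) :=
  r2prime3_of_Zsum p hp ends h12 h31 h32 ho ho2 hb2 hPD
    (zsum_of_regime p hp ends hb1 hb2 hord hreg) hord h3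

end ZRegime

end Summit.Ventures.PercRepro2
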